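import Literature.MathematicalPhysics.QuantumFieldTheory.Balaban1983to89.B8Ineq198MultiLevelTorusP22
import Literature.MathematicalPhysics.QuantumFieldTheory.Balaban1983to89.B6Prop23MultiLevelTorus

/-!
# `Balaban1983to89.B8Ineq198MultiLevelTorusP23` — T. Bałaban, *Spaces of regular gauge field configurations on a lattice and gauge
# fixing conditions*, Commun. Math. Phys. **99** (1985) 75–102 [Balaban1985RegularSpaces], p. 92 **(1.98) R-half** «|Rf|₍₋₂₎ ≦ B′₀|f|₍₋₂₎»
# and the composite letter **`G′R` of (1.100)–(1.101)** p. 93 **AT U₀ = 1 ON PRINT'S CARRIER — THE GENUINE `k`-LEVEL NESTED-DOMAIN TORUS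
# FAMILY `T_η = Ω₁ ⊃ … ⊃ Ω_k` — HYPOTHESIS-FREE**: the last argument `G` of `B8Ineq198MultiLevelTorusP22` instantiated with THE inverse
# `(Q′G′²Q′*)⁻¹ = GinvT D a` of [B6] Proposition 2.3 for this family (`B6Prop23MultiLevelTorus.prop23_multiLevelTorus`, seat p21 gen 16,
# p350221, 2026-08-23T02:58Z)

statement-level skeleton of published theorems with citation tags; proofs where landed; nothing here is a claim about the Yang–Mills mass gap

CITATION HEADER (lean-in-tree rule).  Cell `lit-balaban`, unit `lit-balaban-r05` gen 59 (B8 reader/typer and fold owner; the announced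
successor step of `B8Ineq198MultiLevelTorus` p344001 / `B8Ineq198MultiLevelTorusP22` p344806, HOME/lit-balaban-r05/HANDOFF.md § gen 54–58
trigger (iii-c)).  WHAT IS REPRODUCED = SKELETON rows **B8.Eq1.99** (member (1.98), R-half) and **B8.Eq1.101** (the composite `G′R` of
(1.100)–(1.101)) at the flat background ON PRINT'S OWN CARRIER `T_η`, NOW WITH NO HYPOTHESIS: `B8Ineq198MultiLevelTorusP22` proved
«|Rf|₍₋ₙ₎ ≦ B′₀|f|₍₋ₙ₎» (pointwise and in print's p. 86 norm `|·|₍α₎`) and the `G′R` bounds for EVERY operator `G` on `𝔅` carrying the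
printed (2.87)-bound of `(Q′G′²Q′*)⁻¹`, the [B6] Prop.-2.2 torus entries already discharged there by p21's T4–T7; p21's
`B6Prop23MultiLevelTorus.prop23_multiLevelTorus` (G2 of the torus `(Q′G′²Q′*)⁻¹` programme) now supplies THE operator `GinvT D a` (a
definition with a body) with `GinvT·(Q′G′²Q′*) = 1`, `(Q′G′²Q′*)·GinvT = 1` and (2.87) in exactly the letters consumed.  This file is the
three-line composition for print's own `R = 1 − G′Q′*(Q′G′²Q′*)⁻¹Q′G′` (`rProjMLT D a (GinvT D a)`) and `P = 1 − R` (`pProjMLT D a (GinvT D a)`):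
(1.98) R-half for every exponent `n` (pointwise and in `|·|₍₋ₙ₎`) and the `G′R` letter of (1.100)–(1.101), constants depending on
`d, ℓ`, the windows (and `n`) only.  ((1.101) itself — the four `G′` bounds — is already hypothesis-free in
`B8Ineq198MultiLevelTorusP22.ineq1101_multiLevelTorus(_two/_msup)_P22`: no inverse enters there.)  Kind «kernel-checked proof of a model
instance»; theorems only; every input BY NAME; 0 sorry; no fact minted.

WHAT IS PRINTED (verbatim, held text `paper:balaban1985-cmp99-regular-spaces-gauge-fixing`).  p. 92 [p0018 L16–17]: *"Let us recall
that from Theorems 3.1, 3.2 of [4] it follows that |Rf| ≦ B′₀|f|"*; p. 92 [p0018 L35–37]: *"The operators R and V are bounded in this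
norm, and we have |Rf|₍₋₂₎ ≦ B′₀|f|₍₋₂₎, |Vf|₍₋₂₎ ≦ O(α₄)|f|₍₋₂₎. (1.98) Thus it is a function with a bounded norm |·|₍₋₂₎."*;
p. 93 [p0019 L17–19]: *"One of the results of [4], Theorem 3.1, tells us that G′ is a bounded operator from a space with the norm
|·|₍₋₂₎ into a space with the norm |·| for functions, and the norm |·|₍₋₁₎ for their first derivatives."*, (1.100) «λ = G′RD\*A + G′R𝔉₄(λ, Dλ, A, D\*A)»; p. 86 (the norms `|·|₍α₎` after (1.55)).  [4] CMP **99**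
[Balaban1985BackgroundPropagators] (3.25) p. 394, (3.47) p. 398, (3.49) p. 399; [B6] CMP **96** [Balaban1984PropagatorsII] Prop. 2.3
(2.87) p. 238 [p0016 L13–18], p. 235 [p0013 L19–20] «Of course the operator Q′G′²Q′\* is positive definite, so its inverse is well
defined», Prop. 2.2 (2.67) p. 234, p. 224 «we admit the case when some domains Ω_j are equal to T_η».

HONEST SCOPE / NOT CLAIMED.  As `B8Ineq198MultiLevelTorus(P22)`: print's carrier `T_η` with `Ω₁ = T_η` (levels `1 … k`), `A = 0`
(U₀ = 1), scalar fibre, lattice units (η = 1), `∇_μ = dT N₀ μ`, the weight `(L^{j(z)})⁻ⁿ` read at each point's own level,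
`|·|₍α₎ = B8ScaledSupNorm.msup (ℓ+1) k 1 α (Ω_j = {z : j ≤ lev z})`; constants existential (functions of `d, ℓ`, the windows, `n`);
thresholds «M, RM sufficiently large» explicit (`M_h ≥ 3`, `L·M_h ≥ M₀`, `R ≥ 2L`, `R·L·M_h ≥ N₀ + 1`, periods `P_μ ≥ 4`).  The H′-half
of (1.98) on `T_η` is `B8Ineq192MultiLevelTorusP23.ineq192_multiLevelTorus_P23` (companion file); the general (1.98)/(1.99) at a
background `U₀ ∈ 𝔄_k` ([4] Thms 3.1–3.3) stays the typed leaf of `B8Ineq198R` / `B8Ineq192Op`; rows B8.Eq1.99 / B8.Eq1.101 /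
B8.Claim@92 heads NOT changed (owner's word).  NOT summit progress, NOT continuum, NOT Clay.
-/

namespace Literature.MathematicalPhysics.QuantumFieldTheory.Balaban1983to89.B8Ineq198MultiLevelTorusP23

open Matrix
open B4Reflection242 (boxDom)
open B6MultiLevelBoxOperator
open B6MultiLevelTorusOperator
open B6Geom246MultiLevelBox
open B6Geom246MultiLevelTorus
open B6Ineq268MultiLevelBox
open B6Ineq243TwoLevelBox (aNext)
open B6Expansion282 (kerOp)
open B6Prop23Chain (mat)
open B6Prop22DerivMultiLevelTorus (dT)
open B6Prop23MultiLevelTorus (GinvT prop23_multiLevelTorus)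
open B8ScaledSupNorm (msup)
open B8Ineq192MultiLevelTorus (XkT rProjMLT)
open B9Ineq349MultiLevelTorus (pProjMLT)
open B8Ineq198MultiLevelTorusP22 (ineq198R_multiLevelTorus_P22 ineq1101_GR_multiLevelTorus_P22 ineq198R_multiLevelTorus_msup_P22)

noncomputable section

variable {d : ℕ}

/-- **(1.98), R-HALF, AT U₀ = 1 ON PRINT'S CARRIER `T_η` — HYPOTHESIS-FREE** («|Rf|₍₋₂₎ ≦ B′₀|f|₍₋₂₎», here every exponent `n`), for
print's own `R = 1 − G′Q′*(Q′G′²Q′*)⁻¹Q′G′` (`rProjMLT D a (GinvT D a)`) and `P = 1 − R` (`pProjMLT D a (GinvT D a)`), THE inverse of [B6]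
Prop. 2.3 inside: for every `n` there are `B′₀, M₀ > 0`, `N₀ ≥ 1` (functions of `d, ℓ`, the windows, `n`) such that for every member of
the torus family in print's regime (`M_h ≥ 3`, `L·M_h ≥ M₀`, `R ≥ 2L`, `R·L·M_h ≥ N₀ + 1`, `P_μ ≥ 4`, windowed weights with the
recursion), `GinvT·(Q′G′²Q′*) = 1 = (Q′G′²Q′*)·GinvT` and, for every `f` with `|f(z)| ≦ S(L^{j(z)})⁻ⁿ` and every point `x`:
`|(Pf)(x)| ≦ B′₀(L^{j(x)})⁻ⁿS` and **`|(Rf)(x)| ≦ B′₀(L^{j(x)})⁻ⁿS`** — `B8Ineq198MultiLevelTorusP22.ineq198R_multiLevelTorus_P22` ∘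
`prop23_multiLevelTorus`. [cite: Balaban1985RegularSpaces, (1.98) p.92, (1.27) p.80; Balaban1985BackgroundPropagators, (3.49) p.399, (3.47) p.398, (3.25) p.394; Balaban1984PropagatorsII, Prop. 2.3 (2.87) p.238, Prop. 2.2 (2.67) p.234, p.235, p.224 (Ω₁ = T_η admitted)] -/
theorem ineq198R_multiLevelTorus_P23 (d ℓ : ℕ) (hℓ : 1 ≤ ℓ) (aminus aplus a2minus a2plus : ℝ) (ha : 0 < aminus)
    (ha2 : 0 < a2minus) (n : ℕ) :
    ∃ B₀' M₀ : ℝ, ∃ N₀ : ℕ, 0 < B₀' ∧ 0 < M₀ ∧ 0 < N₀ ∧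
      ∀ (k Mh R : ℕ), 3 ≤ Mh → M₀ ≤ ((ℓ : ℝ) + 1) * Mh → 2 * (ℓ + 1) ≤ R → N₀ + 1 ≤ R * ((ℓ + 1) * Mh) →
      ∀ (P : Fin (d + 1) → ℕ) (_hP : ∀ μ, 1 ≤ P μ) (_hP4 : ∀ μ, 4 ≤ P μ) (D : TDomains d ℓ Mh k P R) (a c : ℕ → ℝ),
        (∀ i, 1 ≤ i → aminus ≤ a i ∧ a i ≤ aplus) → (∀ i, 1 ≤ i → a2minus ≤ c i ∧ c i ≤ a2plus) →
        (∀ i, 1 ≤ i → a (i + 1) = aNext ℓ (a i) (c i)) →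
        GinvT D a * kerOp (W D.toDomains) (XkT D a) = 1 ∧ kerOp (W D.toDomains) (XkT D a) * GinvT D a = 1 ∧
        ∀ (f : ↥(boxDom (N0 ℓ Mh k P)) → ℝ) (S : ℝ), 0 ≤ S →
          (∀ z : ↥(boxDom (N0 ℓ Mh k P)), |f z| ≤ S * ((((ℓ : ℝ) + 1) ^ D.lev z.1) ^ n)⁻¹) →
          ∀ x : ↥(boxDom (N0 ℓ Mh k P)),
            |pProjMLT D a (GinvT D a) f x| ≤ B₀' * ((((ℓ : ℝ) + 1) ^ D.lev x.1) ^ n)⁻¹ * S ∧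
            |rProjMLT D a (GinvT D a) f x| ≤ B₀' * ((((ℓ : ℝ) + 1) ^ D.lev x.1) ^ n)⁻¹ * S := by
  obtain ⟨δ₁, C₁, M₁, hδ₁, hC₁, hM₁, hP23⟩ := prop23_multiLevelTorus d ℓ hℓ aminus aplus a2minus a2plus ha ha2
  obtain ⟨B₀', M₀, N₀, hB, hM₀, hN₀, h⟩ :=
    ineq198R_multiLevelTorus_P22 d ℓ hℓ aminus aplus a2minus a2plus ha ha2 hC₁ hδ₁ n
  refine ⟨B₀', max M₀ M₁, N₀, hB, lt_max_of_lt_left hM₀, hN₀, ?_⟩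
  intro k Mh R hMh hM hRL hRM P hP hP4 D a c haw hcw hac
  obtain ⟨h1, h2, -, hG⟩ := hP23 k Mh R ((le_max_right _ _).trans hM) hRL P hP hP4 D a c haw hcw hac
  exact ⟨h1, h2, h k Mh R hMh ((le_max_left _ _).trans hM) hRL hRM P hP hP4 D a c haw hcw hac (GinvT D a) hG⟩

/-- **THE COMPOSITE LETTER `G′R` OF (1.100)–(1.101) AT U₀ = 1 ON PRINT'S CARRIER `T_η` — HYPOTHESIS-FREE** («λ = G′RD\*A +
G′R𝔉₄(λ, Dλ, A, D\*A) … |G′R𝔉|, |DG′R𝔉|₍₋₁₎ ≦ O(1)B′₀ξ₁(…) on Ω_j»), for print's own `R = rProjMLT D a (GinvT D a)` and the GENUINE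
`G′ = gmlT`, `∇_μ = dT N₀ μ`: there are `C″, M₀ > 0`, `N₀ ≥ 1` such that for every member of the family in print's regime, every `f` with
`|f(z)| ≦ S(L^{j(z)})⁻²` and every point `x` at its level `j`: `|(G′Rf)(x)| ≦ C″S` and `|(∇_μG′Rf)(x)| ≦ C″(Lʲ)⁻¹S` (every axis) —
`B8Ineq198MultiLevelTorusP22.ineq1101_GR_multiLevelTorus_P22` ∘ `prop23_multiLevelTorus`.
[cite: Balaban1985RegularSpaces, (1.100)–(1.101) p.93, (1.98) p.92; Balaban1985BackgroundPropagators, Theorem 3.1 p.397, (3.47) p.398, (3.49) p.399, (3.25) p.394; Balaban1984PropagatorsII, Prop. 2.3 (2.87) p.238, Prop. 2.2 (2.67) p.234, p.224] -/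
theorem ineq1101_GR_multiLevelTorus_P23 (d ℓ : ℕ) (hℓ : 1 ≤ ℓ) (aminus aplus a2minus a2plus : ℝ) (ha : 0 < aminus)
    (ha2 : 0 < a2minus) :
    ∃ C'' M₀ : ℝ, ∃ N₀ : ℕ, 0 < C'' ∧ 0 < M₀ ∧ 0 < N₀ ∧
      ∀ (k Mh R : ℕ), 3 ≤ Mh → M₀ ≤ ((ℓ : ℝ) + 1) * Mh → 2 * (ℓ + 1) ≤ R → N₀ + 1 ≤ R * ((ℓ + 1) * Mh) →
      ∀ (P : Fin (d + 1) → ℕ) (_hP : ∀ μ, 1 ≤ P μ) (_hP4 : ∀ μ, 4 ≤ P μ) (D : TDomains d ℓ Mh k P R) (a c : ℕ → ℝ),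
        (∀ i, 1 ≤ i → aminus ≤ a i ∧ a i ≤ aplus) → (∀ i, 1 ≤ i → a2minus ≤ c i ∧ c i ≤ a2plus) →
        (∀ i, 1 ≤ i → a (i + 1) = aNext ℓ (a i) (c i)) →
        GinvT D a * kerOp (W D.toDomains) (XkT D a) = 1 ∧ kerOp (W D.toDomains) (XkT D a) * GinvT D a = 1 ∧
        ∀ (f : ↥(boxDom (N0 ℓ Mh k P)) → ℝ) (S : ℝ), 0 ≤ S →
          (∀ z : ↥(boxDom (N0 ℓ Mh k P)), |f z| ≤ S * ((((ℓ : ℝ) + 1) ^ D.lev z.1) ^ 2)⁻¹) →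
          ∀ x : ↥(boxDom (N0 ℓ Mh k P)),
            |(gmlT (N0 ℓ Mh k P) ℓ k D.lev a *ᵥ rProjMLT D a (GinvT D a) f) x| ≤ C'' * S ∧
            ∀ μ : Fin (d + 1),
              |(dT (N0 ℓ Mh k P) μ *ᵥ (gmlT (N0 ℓ Mh k P) ℓ k D.lev a *ᵥ rProjMLT D a (GinvT D a) f)) x| ≤
                C'' * (((ℓ : ℝ) + 1) ^ D.lev x.1)⁻¹ * S := by
  obtain ⟨δ₁, C₁, M₁, hδ₁, hC₁, hM₁, hP23⟩ := prop23_multiLevelTorus d ℓ hℓ aminus aplus a2minus a2plus ha ha2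
  obtain ⟨C'', M₀, N₀, hC'', hM₀, hN₀, h⟩ :=
    ineq1101_GR_multiLevelTorus_P22 d ℓ hℓ aminus aplus a2minus a2plus ha ha2 hC₁ hδ₁
  refine ⟨C'', max M₀ M₁, N₀, hC'', lt_max_of_lt_left hM₀, hN₀, ?_⟩
  intro k Mh R hMh hM hRL hRM P hP hP4 D a c haw hcw hac
  obtain ⟨h1, h2, -, hG⟩ := hP23 k Mh R ((le_max_right _ _).trans hM) hRL P hP hP4 D a c haw hcw hac
  exact ⟨h1, h2, h k Mh R hMh ((le_max_left _ _).trans hM) hRL hRM P hP hP4 D a c haw hcw hac (GinvT D a) hG⟩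

/-- **(1.98), R-HALF, IN PRINT'S OWN NORM `|·|₍α₎` OF p. 86 ON `T_η` — HYPOTHESIS-FREE: «|Rf|₍₋ₙ₎ ≦ B′₀|f|₍₋ₙ₎»** (and `|Pf|₍₋ₙ₎ ≦
B′₀|f|₍₋ₙ₎`), `|·|₍α₎ = B8ScaledSupNorm.msup (ℓ+1) k 1 α (Ω_j = {z : j ≤ lev z})`, for print's own `R = rProjMLT D a (GinvT D a)` and `P =
pProjMLT D a (GinvT D a)` on every member of the torus family in print's regime — `B8Ineq198MultiLevelTorusP22.ineq198R_multiLevelTorus_msup_P22`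
∘ `prop23_multiLevelTorus`. [cite: Balaban1985RegularSpaces, (1.98) p.92, p.86 (definition after (1.55)); Balaban1985BackgroundPropagators, (3.41) p.397, (3.49) p.399, (3.25) p.394; Balaban1984PropagatorsII, Prop. 2.3 (2.87) p.238, Prop. 2.2 (2.67) p.234, p.224] -/
theorem ineq198R_multiLevelTorus_msup_P23 (d ℓ : ℕ) (hℓ : 1 ≤ ℓ) (aminus aplus a2minus a2plus : ℝ) (ha : 0 < aminus)
    (ha2 : 0 < a2minus) (n : ℕ) :
    ∃ B₀' M₀ : ℝ, ∃ N₀ : ℕ, 0 < B₀' ∧ 0 < M₀ ∧ 0 < N₀ ∧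
      ∀ (k Mh R : ℕ), 3 ≤ Mh → M₀ ≤ ((ℓ : ℝ) + 1) * Mh → 2 * (ℓ + 1) ≤ R → N₀ + 1 ≤ R * ((ℓ + 1) * Mh) →
      ∀ (P : Fin (d + 1) → ℕ) (_hP : ∀ μ, 1 ≤ P μ) (_hP4 : ∀ μ, 4 ≤ P μ) (D : TDomains d ℓ Mh k P R) (a c : ℕ → ℝ),
        (∀ i, 1 ≤ i → aminus ≤ a i ∧ a i ≤ aplus) → (∀ i, 1 ≤ i → a2minus ≤ c i ∧ c i ≤ a2plus) →
        (∀ i, 1 ≤ i → a (i + 1) = aNext ℓ (a i) (c i)) →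
        GinvT D a * kerOp (W D.toDomains) (XkT D a) = 1 ∧ kerOp (W D.toDomains) (XkT D a) * GinvT D a = 1 ∧
        ∀ f : ↥(boxDom (N0 ℓ Mh k P)) → ℝ,
          msup (ℓ + 1) k 1 (-(n : ℝ)) (fun j (z : ↥(boxDom (N0 ℓ Mh k P))) => j ≤ D.lev z.1)
              (rProjMLT D a (GinvT D a) f) ≤
            B₀' * msup (ℓ + 1) k 1 (-(n : ℝ)) (fun j (z : ↥(boxDom (N0 ℓ Mh k P))) => j ≤ D.lev z.1) f ∧
          msup (ℓ + 1) k 1 (-(n : ℝ)) (fun j (z : ↥(boxDom (N0 ℓ Mh k P))) => j ≤ D.lev z.1)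
              (pProjMLT D a (GinvT D a) f) ≤
            B₀' * msup (ℓ + 1) k 1 (-(n : ℝ)) (fun j (z : ↥(boxDom (N0 ℓ Mh k P))) => j ≤ D.lev z.1) f := by
  obtain ⟨δ₁, C₁, M₁, hδ₁, hC₁, hM₁, hP23⟩ := prop23_multiLevelTorus d ℓ hℓ aminus aplus a2minus a2plus ha ha2
  obtain ⟨B₀', M₀, N₀, hB, hM₀, hN₀, h⟩ :=
    ineq198R_multiLevelTorus_msup_P22 d ℓ hℓ aminus aplus a2minus a2plus ha ha2 hC₁ hδ₁ n
  refine ⟨B₀', max M₀ M₁, N₀, hB, lt_max_of_lt_left hM₀, hN₀, ?_⟩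
  intro k Mh R hMh hM hRL hRM P hP hP4 D a c haw hcw hac
  obtain ⟨h1, h2, -, hG⟩ := hP23 k Mh R ((le_max_right _ _).trans hM) hRL P hP hP4 D a c haw hcw hac
  exact ⟨h1, h2, h k Mh R hMh ((le_max_left _ _).trans hM) hRL hRM P hP hP4 D a c haw hcw hac (GinvT D a) hG⟩

end

end Literature.MathematicalPhysics.QuantumFieldTheory.Balaban1983to89.B8Ineq198MultiLevelTorusP23
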